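import Mathlib
import HarnessLib
import Literature.Probability.Percolation.MinOpenCut
import Literature.Probability.Percolation.MinOpenCutMenger
import Summits.CriticalPhenomena.PercolationContinuityZ3.Theses.PercBudgetLadder
import Summits.CriticalPhenomena.PercolationContinuityZ3.Theorems.PercBudgetLadderBudgetTightnessDictionary

/-!
# Strategist census, crux `BudgetTightness` (stmt-CriticalPhenomena-5248): the best TYPED SPLIT
# `T1 ∧ T2 → BudgetTightness` (cluster COUNT × per-cluster THROUGHPUT), kernel-checked glue

Planner-cstrat seat `planner-cstrat-stmt-CriticalPhenomena-5248-s1-0`, 2026-08-17. This file is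
CENSUS EVIDENCE (`STRATEGY-CENSUS.md`, heading `## Decomposition`), not a registered line and not a
filed route split: it shows that the one decomposition of the crux that is not a re-coordinatisation
is typeable and that its glue is provable NOW from the landed dictionary
(`Theorems/PercBudgetLadderBudgetTightnessDictionary.lean`, p102875), and records (docstrings) why
neither piece is more attackable than the crux.

Notation (all statements def-free, verbatim over tree declarations, as in `Lines/Sketch.lean`):
`Q(L,h) = Set.Icc ![0,0,0] ![L,L,h]`, bottom `Set.Icc ![0,0,0] ![L,L,0]`, top `Set.Icc ![0,0,h] ![L,L,h]`,
`S(L,h) = minOpenCutIn Q bottom top` (bottom-to-top min-cut = max number of edge-disjoint open vertical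
crossings), `N(L,h)` = number of open clusters of `Q(L,h)` meeting bottom and top, `E = ∫ · ∂P_{p_c(ℤ³)}`.

* `T1 = SlabCrossingClusterDensity` : `∃ C h₀, ∀ h ≥ h₀, ∀ L ≥ h, h²·E[N(L,h)] ≤ C·L²` — tight density of
  crossing CLUSTERS for all large thicknesses (the `d < 6` hyperscaling count "O((L/h)²) spanning clusters";
  Aizenman 1997 proves `d = 2` by RSW; FALSE for `d ≥ 7` under `η = 0`; TRUE in a hypothetical dense-giant
  world `θ(p_c) > 0`). Its i.o. weakening is NECESSARY for the crux (landed: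
  `numCrossingQuadraticIO_of_budgetTightness`).
* `T2 = PerClusterThroughputIO` : `∃ K, ∀ H, ∃ h ≥ H, ∀ L ≥ h, h²·E[S(L,h)] ≤ K·(h²·E[N(L,h)]) + K·L²` —
  bounded mean THROUGHPUT per crossing cluster along a subsequence (numerically `E S / E N ≈ 1.5` flat,
  kit j018005). NECESSARY for the crux (`perClusterThroughputIO_of_budgetTightness` below, one line from the
  landed converse dictionary); dimension-free-looking but FALSE at `p = 1` / `p > p_c` (one giant cluster
  carrying `≍ L²` crossings), i.e. it carries the "no giant-like spanning cluster at `p_c`" content.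
* GLUE `budgetTightness_of_split : T1 → T2 → BudgetTightness` (sorry-free): `h² E S ≤ K⁺ h² E N + K⁺ L² ≤
  (K⁺C⁺ + K⁺) L²` along T2's thicknesses `h ≥ max h₀ 1`, then `budgetTightness_of_slabCutQuadraticIO`.

Why this is recorded and NOT filed as `route edit --split` (census verdict): T1 is the hyperscaling
cluster count (open-problem class, the piece that fails the d-test `Negative/AboveSix`), T2 is a red-bond /
cut-topology statement about single critical spanning clusters whose only known route to a proof is an
X-type (RSW) lateral-extent bound; the split separates the two admissibility filters found by the leads
(d-test ↦ T1, dense-giant filter ↦ T2) but names no tool for either piece, so filing it would create two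
unstaffable items. It is ready to file verbatim if an input for either piece appears.
-/

noncomputable section

namespace Summit.CriticalPhenomena.PercolationContinuityZ3.Cruxes.BudgetTightness.StrategistCensus

open MeasureTheory Filter Topology
open Literature.Probability.Percolation Literature.Probability.LatticeModels
open Summit.CriticalPhenomena.PercolationContinuityZ3.Theses.PercBudgetLadder (BudgetTightness)
open Summit.CriticalPhenomena.PercolationContinuityZ3.Theorems.BudgetTightness
  (budgetTightness_of_slabCutQuadraticIO slabCutQuadraticIO_of_budgetTightness)

/-- **T1 — tight crossing-cluster density of critical slab pieces, for all large thicknesses.** -/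
def SlabCrossingClusterDensity : Prop :=
  ∃ C : ℝ, ∃ h₀ : ℕ, ∀ h : ℕ, h₀ ≤ h → ∀ L : ℕ, h ≤ L →
    (h : ℝ) ^ 2 * ∫ ω, (({c : ((openGraph ω).induce
        (Set.Icc (![0, 0, 0] : Site 3) ![(L : ℤ), (L : ℤ), (h : ℤ)])).ConnectedComponent |
      (∃ x : ↥(Set.Icc (![0, 0, 0] : Site 3) ![(L : ℤ), (L : ℤ), (h : ℤ)]),
        (x : Site 3) ∈ Set.Icc (![0, 0, 0] : Site 3) ![(L : ℤ), (L : ℤ), 0] ∧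
        ((openGraph ω).induce (Set.Icc (![0, 0, 0] : Site 3) ![(L : ℤ), (L : ℤ), (h : ℤ)])).connectedComponentMk x = c) ∧
      ∃ y : ↥(Set.Icc (![0, 0, 0] : Site 3) ![(L : ℤ), (L : ℤ), (h : ℤ)]),
        (y : Site 3) ∈ Set.Icc (![0, 0, (h : ℤ)] : Site 3) ![(L : ℤ), (L : ℤ), (h : ℤ)] ∧
        ((openGraph ω).induce (Set.Icc (![0, 0, 0] : Site 3) ![(L : ℤ), (L : ℤ), (h : ℤ)])).connectedComponentMk y = c}.encard).toNat : ℝ)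
      ∂(bondPercolation (zdGraph 3) (criticalProbI 3)) ≤ C * (L : ℝ) ^ 2

/-- **T2 — bounded mean throughput per crossing cluster along a subsequence of thicknesses**
(division-free form: `h²·E S ≤ K·(h²·E N) + K·L²`). -/
def PerClusterThroughputIO : Prop :=
  ∃ K : ℝ, ∀ H : ℕ, ∃ h : ℕ, H ≤ h ∧ ∀ L : ℕ, h ≤ L →
    (h : ℝ) ^ 2 * ∫ ω, ((minOpenCutIn
        (Set.Icc (![0, 0, 0] : Site 3) ![(L : ℤ), (L : ℤ), (h : ℤ)])
        (Set.Icc (![0, 0, 0] : Site 3) ![(L : ℤ), (L : ℤ), 0])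
        (Set.Icc (![0, 0, (h : ℤ)] : Site 3) ![(L : ℤ), (L : ℤ), (h : ℤ)])
        ω).toNat : ℝ) ∂(bondPercolation (zdGraph 3) (criticalProbI 3)) ≤
      K * ((h : ℝ) ^ 2 * ∫ ω, (({c : ((openGraph ω).induce
        (Set.Icc (![0, 0, 0] : Site 3) ![(L : ℤ), (L : ℤ), (h : ℤ)])).ConnectedComponent |
      (∃ x : ↥(Set.Icc (![0, 0, 0] : Site 3) ![(L : ℤ), (L : ℤ), (h : ℤ)]),
        (x : Site 3) ∈ Set.Icc (![0, 0, 0] : Site 3) ![(L : ℤ), (L : ℤ), 0] ∧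
        ((openGraph ω).induce (Set.Icc (![0, 0, 0] : Site 3) ![(L : ℤ), (L : ℤ), (h : ℤ)])).connectedComponentMk x = c) ∧
      ∃ y : ↥(Set.Icc (![0, 0, 0] : Site 3) ![(L : ℤ), (L : ℤ), (h : ℤ)]),
        (y : Site 3) ∈ Set.Icc (![0, 0, (h : ℤ)] : Site 3) ![(L : ℤ), (L : ℤ), (h : ℤ)] ∧
        ((openGraph ω).induce (Set.Icc (![0, 0, 0] : Site 3) ![(L : ℤ), (L : ℤ), (h : ℤ)])).connectedComponentMk y = c}.encard).toNat : ℝ)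
      ∂(bondPercolation (zdGraph 3) (criticalProbI 3))) + K * (L : ℝ) ^ 2

/-- **GLUE (sorry-free): `T1 → T2 → BudgetTightness`.** Along T2's thicknesses `h ≥ max h₀ 1`,
`h² E S ≤ K⁺ (h² E N) + K⁺ L² ≤ (K⁺ C⁺ + K⁺) L²` by T1, i.e. `SlabCutQuadraticIO(p_c)`, then the landed
dictionary `budgetTightness_of_slabCutQuadraticIO` (six lids + Markov). -/
theorem budgetTightness_of_split (h1 : SlabCrossingClusterDensity) (h2 : PerClusterThroughputIO) :
    BudgetTightness := by
  obtain ⟨C, h₀, hC⟩ := h1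
  obtain ⟨K, hK⟩ := h2
  refine budgetTightness_of_slabCutQuadraticIO ⟨max K 0 * max C 0 + max K 0, fun H => ?_⟩
  obtain ⟨h, hHh, hL⟩ := hK (max H (max h₀ 1))
  have hh₀ : h₀ ≤ h := le_trans (le_trans (le_max_left _ _) (le_max_right _ _)) hHh
  refine ⟨h, le_trans (le_max_left _ _) hHh, fun L hLh => ?_⟩
  have hT2 := hL L hLh
  have hT1 := hC h hh₀ L hLh
  -- abbreviate the two integrals
  set IS : ℝ := ∫ ω, ((minOpenCutIn
        (Set.Icc (![0, 0, 0] : Site 3) ![(L : ℤ), (L : ℤ), (h : ℤ)])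
        (Set.Icc (![0, 0, 0] : Site 3) ![(L : ℤ), (L : ℤ), 0])
        (Set.Icc (![0, 0, (h : ℤ)] : Site 3) ![(L : ℤ), (L : ℤ), (h : ℤ)])
        ω).toNat : ℝ) ∂(bondPercolation (zdGraph 3) (criticalProbI 3)) with hIS
  set IN : ℝ := ∫ ω, (({c : ((openGraph ω).induce
        (Set.Icc (![0, 0, 0] : Site 3) ![(L : ℤ), (L : ℤ), (h : ℤ)])).ConnectedComponent |
      (∃ x : ↥(Set.Icc (![0, 0, 0] : Site 3) ![(L : ℤ), (L : ℤ), (h : ℤ)]),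
        (x : Site 3) ∈ Set.Icc (![0, 0, 0] : Site 3) ![(L : ℤ), (L : ℤ), 0] ∧
        ((openGraph ω).induce (Set.Icc (![0, 0, 0] : Site 3) ![(L : ℤ), (L : ℤ), (h : ℤ)])).connectedComponentMk x = c) ∧
      ∃ y : ↥(Set.Icc (![0, 0, 0] : Site 3) ![(L : ℤ), (L : ℤ), (h : ℤ)]),
        (y : Site 3) ∈ Set.Icc (![0, 0, (h : ℤ)] : Site 3) ![(L : ℤ), (L : ℤ), (h : ℤ)] ∧
        ((openGraph ω).induce (Set.Icc (![0, 0, 0] : Site 3) ![(L : ℤ), (L : ℤ), (h : ℤ)])).connectedComponentMk y = c}.encard).toNat : ℝ)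
      ∂(bondPercolation (zdGraph 3) (criticalProbI 3)) with hIN
  have hINnn : 0 ≤ IN := integral_nonneg fun ω => Nat.cast_nonneg _
  have hX : 0 ≤ (h : ℝ) ^ 2 * IN := mul_nonneg (by positivity) hINnn
  have hL2 : 0 ≤ (L : ℝ) ^ 2 := by positivity
  -- replace K by K⁺ = max K 0 and C by C⁺ = max C 0
  have step1 : (h : ℝ) ^ 2 * IS ≤ max K 0 * ((h : ℝ) ^ 2 * IN) + max K 0 * (L : ℝ) ^ 2 :=
    hT2.trans (add_le_add (mul_le_mul_of_nonneg_right (le_max_left _ _) hX)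
      (mul_le_mul_of_nonneg_right (le_max_left _ _) hL2))
  have step2 : (h : ℝ) ^ 2 * IN ≤ max C 0 * (L : ℝ) ^ 2 :=
    hT1.trans (mul_le_mul_of_nonneg_right (le_max_left _ _) hL2)
  have hK0 : 0 ≤ max K 0 := le_max_right _ _
  calc (h : ℝ) ^ 2 * IS ≤ max K 0 * ((h : ℝ) ^ 2 * IN) + max K 0 * (L : ℝ) ^ 2 := step1
    _ ≤ max K 0 * (max C 0 * (L : ℝ) ^ 2) + max K 0 * (L : ℝ) ^ 2 := by
        gcongr
    _ = (max K 0 * max C 0 + max K 0) * (L : ℝ) ^ 2 := by ring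

/-- **T2 is NECESSARY for the crux** (so the split loses nothing on the throughput side): from the
landed converse dictionary `slabCutQuadraticIO_of_budgetTightness` (`h² E S ≤ C L²` i.o.) with `K = C⁺`,
dropping the non-negative cluster-count term. -/
theorem perClusterThroughputIO_of_budgetTightness (hBT : BudgetTightness) : PerClusterThroughputIO := by
  obtain ⟨C, hcore⟩ := slabCutQuadraticIO_of_budgetTightness hBT
  refine ⟨max C 0, fun H => ?_⟩
  obtain ⟨h, hHh, hL⟩ := hcore H
  refine ⟨h, hHh, fun L hLh => ?_⟩
  have h1 := hL L hLh
  have hL2 : 0 ≤ (L : ℝ) ^ 2 := by positivity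
  have hIN : 0 ≤ (h : ℝ) ^ 2 * ∫ ω, (({c : ((openGraph ω).induce
        (Set.Icc (![0, 0, 0] : Site 3) ![(L : ℤ), (L : ℤ), (h : ℤ)])).ConnectedComponent |
      (∃ x : ↥(Set.Icc (![0, 0, 0] : Site 3) ![(L : ℤ), (L : ℤ), (h : ℤ)]),
        (x : Site 3) ∈ Set.Icc (![0, 0, 0] : Site 3) ![(L : ℤ), (L : ℤ), 0] ∧
        ((openGraph ω).induce (Set.Icc (![0, 0, 0] : Site 3) ![(L : ℤ), (L : ℤ), (h : ℤ)])).connectedComponentMk x = c) ∧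
      ∃ y : ↥(Set.Icc (![0, 0, 0] : Site 3) ![(L : ℤ), (L : ℤ), (h : ℤ)]),
        (y : Site 3) ∈ Set.Icc (![0, 0, (h : ℤ)] : Site 3) ![(L : ℤ), (L : ℤ), (h : ℤ)] ∧
        ((openGraph ω).induce (Set.Icc (![0, 0, 0] : Site 3) ![(L : ℤ), (L : ℤ), (h : ℤ)])).connectedComponentMk y = c}.encard).toNat : ℝ)
      ∂(bondPercolation (zdGraph 3) (criticalProbI 3)) :=
    mul_nonneg (by positivity) (integral_nonneg fun ω => Nat.cast_nonneg _)
  calc _ ≤ C * (L : ℝ) ^ 2 := h1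
    _ ≤ max C 0 * (L : ℝ) ^ 2 := mul_le_mul_of_nonneg_right (le_max_left _ _) hL2
    _ ≤ max C 0 * _ + max C 0 * (L : ℝ) ^ 2 :=
        le_add_of_nonneg_left (mul_nonneg (le_max_right _ _) hIN)

/-- **Under T1 the crux is EXACTLY T2** (`T1 → (BudgetTightness ↔ T2)`): the split isolates the whole
residual difficulty, given the hyperscaling count, in the per-cluster throughput statement. -/
theorem budgetTightness_iff_throughput_of_density (h1 : SlabCrossingClusterDensity) :
    BudgetTightness ↔ PerClusterThroughputIO :=
  ⟨perClusterThroughputIO_of_budgetTightness, budgetTightness_of_split h1⟩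

end Summit.CriticalPhenomena.PercolationContinuityZ3.Cruxes.BudgetTightness.StrategistCensus

end
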